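import Literature.Analysis.FluidPDE.LFourPressureSliceEstimate
import Literature.Analysis.FluidPDE.LThetaEnergyBalance
import HarnessLib

/-!
# The `L⁴` energy inequality on a slab with the pressure in `L^r(ℝ³)` (Lemarié-Rieusset, Prop. 11.7)

Analysis/FluidPDE proof file (theorems only: no definition, no named fact, no `sorry`).
Search for candidate a priori estimates; no regularity claim. Grönwall step of the `L⁴` energy
method (Lemarié-Rieusset 2016, §11.5 Prop. 11.7, case `2/p + 3/r = 2`, `3/2 < r < ∞`, (11.50):
"and we may conclude by using Grönwall's lemma"): on a slab `[0, T] × ℝ³` carrying a classical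
Navier–Stokes solution in Tao's `L²`-Sobolev class, the balance
`Literature.Analysis.FluidPDE.IsSmoothSpaceTimeOn.lTheta_balance` (`θ = 4`) and the slice
inequality `Literature.Analysis.FluidPDE.lfour_slice_le_of_momentum'` give, by Grönwall's lemma in
`ℝ≥0∞` (`lintegral_gronwall_le`),
`∫|u(s)|⁴ ≤ exp (C(θ,K) (8ν)^{-(1-Θ)/Θ} ∫₀ˢ (C_S‖p(t)‖_{L^r})^{1/θ} dt) ∫|u(0)|⁴`,
`θ = 1 - 3/(2r)`, `Θ = θ/2`, `1/θ = 2r/(2r-3)` (`lfour_energy_le_mul_exp`) — the brick of the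
named fact `Literature.Analysis.FluidPDE.pressureGradientCriterion` between the slice estimate
(`LFourPressureSliceEstimate`) and the assembly. A clone of
`Literature.Analysis.FluidPDE.bdv_enstrophy_le_mul_exp` (`BeiraoDaVeigaEnstrophyGronwall`) with the
enstrophy replaced by `∫|u|⁴`.

## References

* [LemarieRieusset2016] P. G. Lemarié-Rieusset, *The Navier–Stokes problem in the 21st century*,
  CRC Press 2016 — §11.5, Prop. 11.7 proof, (11.50) (PDF p. 364).
* [BerselliGaldi2002] L. C. Berselli, G. P. Galdi, Proc. AMS 130 (2002) 3585–3595 — Thm. 1.1.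
-/

noncomputable section

open MeasureTheory Set Function Filter Topology InnerProductSpace
open scoped ENNReal NNReal ContDiff RealInnerProductSpace Laplacian

namespace Literature.Analysis.FluidPDE

/-! ### The `L⁴` energy inequality on a slab (Grönwall) -/

section Gronwall

/-- **The `L⁴` energy inequality on a slab, pressure form** (Lemarié-Rieusset 2016, proof of
Prop. 11.7, (11.50) and "we may conclude by using Grönwall's lemma"; Berselli–Galdi 2002,
Thm. 1.1). Let `(u, p)` be a classical solution of the unforced Navier–Stokes system with
viscosity `ν > 0` on the closed slab `[0, T] × ℝ³` in Tao's `L²`-Sobolev class (`u`, `∂ₜu`, `p`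
with all `L²` Sobolev norms bounded on `[0, T]`). Let `3/2 < r < ∞`, `θ = 1 - 3/(2r)`,
`Θ = θ/2`, `m = 2r/(r-1)`, `C_S ≥ 0`, and `0 < s ≤ T` such that for a.e. `t ∈ (0, s)` the pressure
slice satisfies `p(t) ∈ L^r` and the Calderón–Zygmund bound `‖p(t)‖_{L^m} ≤ C_S‖u(t)‖²_{L^{2m}}`,
with `A = ∫₀ˢ (C_S‖p(t)‖_{L^r})^{1/θ} dt < ∞` (`1/θ = 2r/(2r-3)`). Then
`∫ |u(s)|⁴ ≤ exp (C(θ,K) (8ν)^{-(1-Θ)/Θ} A) ∫ |u(0)|⁴`,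
`C(θ, K) = Θ(2(1-Θ))^{(1-Θ)/Θ} (8(4K²)^{(1-θ)/2})^{1/Θ}`. Proof: the balance
`IsSmoothSpaceTimeOn.lTheta_balance` at `θ = 4`, the slice bound `lfour_slice_le_of_momentum'`
at a.e. interior time, and Grönwall's lemma `lintegral_gronwall_le` in `ℝ≥0∞`.
[cite: LemarieRieusset2016, §11.5 Prop. 11.7 proof, (11.50) (PDF p. 364)]
[cite: BerselliGaldi2002, Thm. 1.1] -/
theorem lfour_energy_le_mul_exp {ν T : ℝ} (hν : 0 < ν) (hT : 0 < T)
    {u : ℝ → EuclideanSpace ℝ (Fin 3) → EuclideanSpace ℝ (Fin 3)}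
    {p : ℝ → EuclideanSpace ℝ (Fin 3) → ℝ} (hsol : FluidPDE.IsClassicalNSSolutionOn (Icc 0 T) ν 0 u p)
    (hu : HasBoundedSobolevNormsOn (Icc 0 T) u)
    (hut : HasBoundedSobolevNormsOn (Icc 0 T) (FluidPDE.timeDerivWithin (Icc 0 T) u))
    (hp : ∀ n : ℕ, ∃ C : ℝ≥0, ∀ t ∈ Icc 0 T, ∫⁻ x, ‖iteratedFDeriv ℝ n (p t) x‖ₑ ^ 2 ≤ C)
    {r : ℝ≥0∞} (hr : 3 / 2 < r) (hrtop : r ≠ ⊤) {θ Θ : ℝ} (hθ : θ = 1 - 3 / (2 * r.toReal))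
    (hΘ : Θ = θ / 2) {CS : ℝ≥0} {s : ℝ} (hs : s ∈ Ioc 0 T)
    (hLr : ∀ᵐ t ∂volume, t ∈ Ioo 0 s → eLpNorm (p t) r volume < ⊤ ∧
      eLpNorm (p t) (ENNReal.ofReal (2 * r.toReal / (r.toReal - 1))) volume ≤
        CS * eLpNorm (u t) (ENNReal.ofReal (2 * (2 * r.toReal / (r.toReal - 1)))) volume ^ 2)
    (hA : ∫⁻ t in Ioo 0 s,
      ENNReal.ofReal (((CS : ℝ) * (eLpNorm (p t) r volume).toReal) ^ (1 / θ)) ≠ ⊤) :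
    ∫⁻ x, ENNReal.ofReal (‖u s x‖ ^ (4 : ℝ)) ≤
      ENNReal.ofReal (Real.exp
        ((Θ * (2 * (1 - Θ)) ^ ((1 - Θ) / Θ) *
            (8 * (4 * (SNormLESNormFDerivOfEqConst ℝ (volume : Measure (EuclideanSpace ℝ (Fin 3))) 2 :
              ℝ) ^ 2) ^ ((1 - θ) / 2)) ^ (1 / Θ)) * (8 * ν) ^ (-((1 - Θ) / Θ)) *
          (∫⁻ t in Ioo 0 s,
            ENNReal.ofReal (((CS : ℝ) * (eLpNorm (p t) r volume).toReal) ^ (1 / θ))).toReal)) *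
        ∫⁻ x, ENNReal.ofReal (‖u 0 x‖ ^ (4 : ℝ)) := by
  set K : ℝ := (SNormLESNormFDerivOfEqConst ℝ (volume : Measure (EuclideanSpace ℝ (Fin 3))) 2 : ℝ)
    with hK
  set C : ℝ := Θ * (2 * (1 - Θ)) ^ ((1 - Θ) / Θ) * (8 * (4 * K ^ 2) ^ ((1 - θ) / 2)) ^ (1 / Θ)
    with hC
  have hU : UniqueDiffOn ℝ (Icc 0 T) := uniqueDiffOn_Icc hT
  set W : ℝ → EuclideanSpace ℝ (Fin 3) → EuclideanSpace ℝ (Fin 3) :=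
    FluidPDE.timeDerivWithin (Icc 0 T) u with hW
  -- the exponents
  have hρ3 : 3 / 2 < r.toReal := by
    have h : ((3 / 2 : ℝ≥0∞)).toReal < r.toReal :=
      (ENNReal.toReal_lt_toReal (ENNReal.div_ne_top (by norm_num) (by norm_num)) hrtop).2 hr
    have h32 : ((3 / 2 : ℝ≥0∞)).toReal = 3 / 2 := by
      rw [ENNReal.toReal_div, ENNReal.toReal_ofNat, ENNReal.toReal_ofNat]
    rw [h32] at h
    exact h
  have hρ0 : 0 < r.toReal := by linarith
  have hθ0 : 0 < θ := by
    rw [hθ, sub_pos, div_lt_one (by positivity)]; linarith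
  have hθ1 : θ < 1 := by
    rw [hθ]; linarith [div_pos (zero_lt_three' ℝ) (by positivity : (0 : ℝ) < 2 * r.toReal)]
  have hΘ0 : 0 < Θ := by rw [hΘ]; positivity
  have hΘ1 : Θ < 1 := by rw [hΘ]; linarith
  have hC0 : 0 ≤ C := by
    have : 0 ≤ 1 - Θ := by linarith
    positivity
  -- pointwise and `L²` bounds on the slab
  obtain ⟨B₀, hB₀⟩ := linfty_bound_of_hasBoundedSobolevNormsOn_holds
    (fun t ht => (hsol.contDiff_velocity ht).of_le (by norm_cast)) hu
  obtain ⟨C₀, hC₀⟩ := hu 0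
  obtain ⟨C₁, hC₁⟩ := hu 1
  obtain ⟨D₂, hD₂⟩ := hu 2
  obtain ⟨E₀, hE₀⟩ := hut 0
  obtain ⟨P₀, hP₀⟩ := hp 0
  obtain ⟨P₁, hP₁⟩ := hp 1
  have hzero : ∀ {f : EuclideanSpace ℝ (Fin 3) → EuclideanSpace ℝ (Fin 3)} {C' : ℝ≥0},
      (∫⁻ x, ‖iteratedFDeriv ℝ 0 f x‖ₑ ^ 2 ≤ C') → ∫⁻ x, ‖f x‖ₑ ^ 2 ≤ C' := by
    intro f C' h
    refine (le_of_eq (lintegral_congr fun x => ?_)).trans h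
    rw [← ofReal_norm, ← ofReal_norm, norm_iteratedFDeriv_zero]
  have hzero' : ∀ {f : EuclideanSpace ℝ (Fin 3) → ℝ} {C' : ℝ≥0},
      (∫⁻ x, ‖iteratedFDeriv ℝ 0 f x‖ₑ ^ 2 ≤ C') → ∫⁻ x, ‖f x‖ₑ ^ 2 < ⊤ := by
    intro f C' h
    refine lt_of_le_of_lt ((le_of_eq (lintegral_congr fun x => ?_)).trans h) ENNReal.coe_lt_top
    rw [← ofReal_norm, ← ofReal_norm, norm_iteratedFDeriv_zero]
  have hB₀0 : 0 ≤ B₀ := (norm_nonneg _).trans (hB₀ 0 ⟨le_rfl, hT.le⟩ 0)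
  -- the `L⁴` balance (`θ = 4`)
  obtain ⟨hΦint, -, hGb⟩ := hsol.smooth_velocity.lTheta_balance hT (θ := 4) (by norm_num) hB₀
    (fun t ht => hzero (hC₀ t ht)) (fun t ht => hzero (hE₀ t ht))
  set Φ : ℝ → ℝ := fun t => ∫ x, 4 * ‖u t x‖ ^ ((4 : ℝ) - 2) * ⟪u t x, W t x⟫ with hΦ
  set G : ℝ → ℝ := fun t => ∫ x, ‖u t x‖ ^ (4 : ℝ) with hG
  have hG0 : ∀ t, 0 ≤ G t := fun t => integral_nonneg fun x => Real.rpow_nonneg (norm_nonneg _) _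
  -- integrability of `‖u t‖⁴` and the uniform bound `G t ≤ B₀² C₀`
  have i_u2 : ∀ t ∈ Icc 0 T, Integrable (fun x => ‖u t x‖ ^ 2) volume := fun t ht =>
    FluidPDE.integrable_sq_norm_of_lintegral_lt_top (hsol.contDiff_velocity ht).continuous
      ((hzero (hC₀ t ht)).trans_lt ENNReal.coe_lt_top)
  have hpt4 : ∀ t ∈ Icc 0 T, ∀ x, ‖u t x‖ ^ (4 : ℝ) ≤ B₀ ^ 2 * ‖u t x‖ ^ 2 := by
    intro t ht x
    rw [Real.rpow_ofNat, show ‖u t x‖ ^ 4 = ‖u t x‖ ^ 2 * ‖u t x‖ ^ 2 by ring]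
    exact mul_le_mul_of_nonneg_right (pow_le_pow_left₀ (norm_nonneg _) (hB₀ t ht x) 2) (sq_nonneg _)
  have i_u4 : ∀ t ∈ Icc 0 T, Integrable (fun x => ‖u t x‖ ^ (4 : ℝ)) volume := by
    intro t ht
    have hc : Continuous fun x => ‖u t x‖ ^ (4 : ℝ) :=
      (hsol.contDiff_velocity ht).continuous.norm.rpow_const fun _ => Or.inr (by norm_num)
    refine ((i_u2 t ht).const_mul (B₀ ^ 2)).mono' hc.aestronglyMeasurable
      (Eventually.of_forall fun x => ?_)
    rw [Real.norm_of_nonneg (Real.rpow_nonneg (norm_nonneg _) _)]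
    exact hpt4 t ht x
  have hGeq : ∀ t ∈ Icc 0 T, ENNReal.ofReal (G t) = ∫⁻ x, ENNReal.ofReal (‖u t x‖ ^ (4 : ℝ)) :=
    fun t ht => ofReal_integral_eq_lintegral_ofReal (i_u4 t ht)
      (Eventually.of_forall fun x => Real.rpow_nonneg (norm_nonneg _) _)
  have hGle : ∀ t ∈ Icc 0 T, ENNReal.ofReal (G t) ≤ ENNReal.ofReal (B₀ ^ 2) * C₀ := by
    intro t ht
    rw [hGeq t ht]
    calc ∫⁻ x, ENNReal.ofReal (‖u t x‖ ^ (4 : ℝ))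
        ≤ ∫⁻ x, ENNReal.ofReal (B₀ ^ 2) * ‖u t x‖ₑ ^ 2 := lintegral_mono fun x => by
          rw [← ofReal_norm, ← ENNReal.ofReal_pow (norm_nonneg _), ← ENNReal.ofReal_mul (sq_nonneg _)]
          exact ENNReal.ofReal_le_ofReal (hpt4 t ht x)
      _ = ENNReal.ofReal (B₀ ^ 2) * ∫⁻ x, ‖u t x‖ₑ ^ 2 := lintegral_const_mul' _ _ ENNReal.ofReal_ne_top
      _ ≤ ENNReal.ofReal (B₀ ^ 2) * C₀ := by gcongr; exact hzero (hC₀ t ht)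
  -- the slice bound at a.e. interior time: `Φ t ≤ κ * Np t * G t`
  set Np : ℝ → ℝ := fun t => ((CS : ℝ) * (eLpNorm (p t) r volume).toReal) ^ (1 / θ) with hNp
  have hNp0 : ∀ t, 0 ≤ Np t := fun t =>
    Real.rpow_nonneg (mul_nonneg CS.coe_nonneg ENNReal.toReal_nonneg) _
  set κ : ℝ := C * (8 * ν) ^ (-((1 - Θ) / Θ)) with hκ
  have hκ0 : 0 ≤ κ := by positivity
  have hslice : ∀ t ∈ Ioo 0 T, eLpNorm (p t) r volume < ⊤ →
      eLpNorm (p t) (ENNReal.ofReal (2 * r.toReal / (r.toReal - 1))) volume ≤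
        CS * eLpNorm (u t) (ENNReal.ofReal (2 * (2 * r.toReal / (r.toReal - 1)))) volume ^ 2 →
      Φ t ≤ κ * Np t * G t := by
    intro t ht hLrt hRzt
    have htI : t ∈ Icc 0 T := Ioo_subset_Icc_self ht
    have hmom : ∀ x, W t x + FluidPDE.convect (u t) (u t) x = ν • (Δ (u t)) x - gradient (p t) x := by
      intro x
      have h := hsol.momentum t htI x
      simpa [hW] using h
    have hsl := lfour_slice_le_of_momentum' hν
      ((hsol.contDiff_velocity htI).of_le (by norm_cast))
      ((hsol.contDiff_pressure htI).of_le (by norm_cast)) hmom (hsol.divFree t htI)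
      (fun x => hB₀ t htI x)
      ((hzero (hC₀ t htI)).trans_lt ENNReal.coe_lt_top) ((hC₁ t htI).trans_lt ENNReal.coe_lt_top)
      ((hD₂ t htI).trans_lt ENNReal.coe_lt_top)
      (hzero' (hP₀ t htI)) ((hP₁ t htI).trans_lt ENNReal.coe_lt_top) hr hrtop hLrt hRzt hθ hΘ
    have hG4 : ∫ x, ‖u t x‖ ^ 4 = G t := by
      rw [hG]
      exact integral_congr_ae (Eventually.of_forall fun x => (Real.rpow_ofNat _ 4).symm)
    rw [hG4] at hsl
    refine hsl.trans_eq ?_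
    simp only [hκ, hC, hNp, hK]
  -- Grönwall in `ℝ≥0∞`
  set φE : ℝ → ℝ≥0∞ := fun t => ENNReal.ofReal (G t) with hφE
  set aE : ℝ → ℝ≥0∞ := fun t => ENNReal.ofReal κ * ENNReal.ofReal (Np t) with haE
  have hM : ∀ t ∈ Icc 0 s, φE t ≤ ENNReal.ofReal (B₀ ^ 2) * C₀ := fun t ht =>
    hGle t ⟨ht.1, ht.2.trans hs.2⟩
  have haS : ∫⁻ t in Ioo 0 s, aE t ≠ ⊤ := by
    rw [haE]; simp only
    rw [lintegral_const_mul' _ _ ENNReal.ofReal_ne_top]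
    exact ENNReal.mul_ne_top ENNReal.ofReal_ne_top hA
  have hcmp : ∀ᵐ τ ∂volume, τ ∈ Ioo 0 s → ENNReal.ofReal (Φ τ) ≤ aE τ * φE τ := by
    filter_upwards [hLr] with τ hτ hτs
    have hτT : τ ∈ Ioo 0 T := ⟨hτs.1, hτs.2.trans_le hs.2⟩
    obtain ⟨hLrt, hRzt⟩ := hτ hτs
    calc ENNReal.ofReal (Φ τ) ≤ ENNReal.ofReal (κ * Np τ * G τ) :=
          ENNReal.ofReal_le_ofReal (hslice τ hτT hLrt hRzt)
      _ = aE τ * φE τ := by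
          rw [haE, hφE]; simp only
          rw [ENNReal.ofReal_mul (mul_nonneg hκ0 (hNp0 τ)), ENNReal.ofReal_mul hκ0]
  have hineq : ∀ t ∈ Icc 0 s, φE t ≤ φE 0 + ∫⁻ τ in Ioo 0 t, aE τ * φE τ := by
    intro t ht
    rcases eq_or_lt_of_le ht.1 with h0 | ht0
    · rw [← h0]; simp
    have htT : t ∈ Ioc 0 T := ⟨ht0, ht.2.trans hs.2⟩
    have hΦt : IntegrableOn Φ (Ioo 0 t) volume := hΦint.mono_set (Ioo_subset_Ioo le_rfl htT.2)
    have h1 : ENNReal.ofReal (∫ τ in Ioo 0 t, Φ τ) ≤ ∫⁻ τ in Ioo 0 t, ENNReal.ofReal (Φ τ) := by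
      calc ENNReal.ofReal (∫ τ in Ioo 0 t, Φ τ) ≤ ENNReal.ofReal (∫ τ in Ioo 0 t, max (Φ τ) 0) :=
            ENNReal.ofReal_le_ofReal (integral_mono hΦt hΦt.pos_part fun τ => le_max_left _ _)
        _ = ∫⁻ τ in Ioo 0 t, ENNReal.ofReal (max (Φ τ) 0) :=
            ofReal_integral_eq_lintegral_ofReal hΦt.pos_part (Eventually.of_forall fun τ => le_max_right _ _)
        _ = ∫⁻ τ in Ioo 0 t, ENNReal.ofReal (Φ τ) := lintegral_congr fun τ => by
            rcases le_total (Φ τ) 0 with h | h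
            · rw [max_eq_right h, ENNReal.ofReal_zero, ENNReal.ofReal_of_nonpos h]
            · rw [max_eq_left h]
    have h2 : ∫⁻ τ in Ioo 0 t, ENNReal.ofReal (Φ τ) ≤ ∫⁻ τ in Ioo 0 t, aE τ * φE τ := by
      refine lintegral_mono_ae ((ae_restrict_iff' measurableSet_Ioo).2 ?_)
      filter_upwards [hcmp] with τ hτ hτt
      exact hτ ⟨hτt.1, hτt.2.trans_le ht.2⟩
    calc φE t = ENNReal.ofReal (G 0 + ∫ τ in (0 : ℝ)..t, Φ τ) := by
          rw [hφE]; simp only; congr 1; exact hGb t htT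
      _ ≤ ENNReal.ofReal (G 0) + ENNReal.ofReal (∫ τ in (0 : ℝ)..t, Φ τ) := ENNReal.ofReal_add_le
      _ = φE 0 + ENNReal.ofReal (∫ τ in Ioo 0 t, Φ τ) := by
          rw [intervalIntegral.integral_of_le ht.1, integral_Ioc_eq_integral_Ioo]
      _ ≤ φE 0 + ∫⁻ τ in Ioo 0 t, aE τ * φE τ := by gcongr; exact h1.trans h2
  have hgron := lintegral_gronwall_le (S := s) ENNReal.ofReal_ne_top
    (ENNReal.mul_ne_top ENNReal.ofReal_ne_top ENNReal.coe_ne_top) hM haS hineq s ⟨hs.1.le, le_rfl⟩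
  -- unpack
  have hint_a : (∫⁻ τ in Ioo 0 s, aE τ).toReal =
      κ * (∫⁻ t in Ioo 0 s, ENNReal.ofReal (Np t)).toReal := by
    rw [haE]; simp only
    rw [lintegral_const_mul' _ _ ENNReal.ofReal_ne_top, ENNReal.toReal_mul, ENNReal.toReal_ofReal hκ0]
  rw [hint_a] at hgron
  rw [← hGeq s ⟨hs.1.le, hs.2⟩, ← hGeq 0 ⟨le_rfl, hT.le⟩, mul_comm]
  convert hgron using 3

end Gronwall

end Literature.Analysis.FluidPDE

end
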